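import Literature.NumberTheory.LFunctions.LargeValuesLongPolynomials
import Literature.NumberTheory.LFunctions.LargeValuesGuthMaynardReduction
import HarnessLib

/-!
# Jutila 1977, large values theorem: the estimate (1.4) from (1.2) at `q = 1`
# (Huxley's subdivision of the points and the optimal window length)

M. Jutila, *Zero-density estimates for `L`-functions*, Acta Arith. **32** (1977), 55–62, proves
his Theorem (p. 56) in three cases; the case of plain Dirichlet polynomials is

  (1.4) `R₃ ≪_{ε,k} (GNV⁻² + TG^{3−1/k}N^{1−1/k}V^{−6+2/k} + T(G⁴N²V⁻⁸)^k) T^ε`,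

typed in the tree as the named fact `Jutila1977_theorem_1_4` (`LargeValuesLongPolynomials.lean`,
with Jutila's set-up: `f(s) = ∑_{N<n≤2N} a_n n^{−s}`, `G = ∑ |a_n|²` = `jutilaG a N`, points
`s_r = σ_r + it_r`, `σ_r ≥ 0`, `|t_r − t_s| ≤ T`, `|t_r − t_s| ≥ 1` for `r ≠ s`, `|f(s_r)| ≥ V > 0`).
The LAST STEP of its proof is printed on p. 60:

  «Finally, for the proof of (1.4), we use (1.2) and the Huxley [5] subdivision of the points
  `s_r`. It means we apply (1.2) with `q = 1`, `T = T₀` and multiply the resulting estimate by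
  `1 + T₀⁻¹T` to get an estimate for `R`; an optimal choice of `T₀` completes the proof.»

where (1.2) is the case of characters to one modulus `q`,

  (1.2) `R₁ ≪_{ε,k} (GNV⁻² + qT(G⁴N²V⁻⁸)^k + (qTG²V⁻⁴)^k)(qT)^ε`,

which at `q = 1` (all characters equal to `χ₀ mod 1`) is a statement about the same plain
Dirichlet polynomials as (1.4). This file formalizes exactly that last step, fact-free:

* `Jutila1977.theorem_1_4_of_theorem_1_2` — **(1.4) from (1.2) at `q = 1`**: the hypothesis is
  (1.2) with `q = 1`, typed verbatim in the binders of `Jutila1977_theorem_1_4` (only the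
  right-hand side differs); the conclusion is `Jutila1977_theorem_1_4`; the constant is
  `2^{k+3} · max C 0` from the constant `C = C(k, ε)` of (1.2).
* `Jutila1977.subdivision_optimisation` — the real-variable content of «multiply by `1 + T₀⁻¹T` …
  optimal choice of `T₀`»: if `R ≤ C(1 + T/T₀)(a + T₀b + (T₀c)^k)` for every `T₀ ∈ [2, T]`, with
  `a ≥ 1`, `c > 0`, `c^k ≤ b`, then `R ≤ 2^{k+3}C(a + Ta^{1−1/k}c + Tb)`; here `a = GNV⁻²`,
  `b = (G⁴N²V⁻⁸)^k`, `c = G²V⁻⁴`, so that `Ta^{1−1/k}c = TG^{3−1/k}N^{1−1/k}V^{−6+2/k}` is the middle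
  term of (1.4); the optimal `T₀` is `a^{1/k}/c`, clamped to `[2, T]`.
* `Jutila1977.card_le_of_window_bound` — «the Huxley subdivision of the points»: a bound `B` for
  every sub-family of points lying in a window of length `T₀` gives `#S ≤ (T/T₀ + 1)B` for a
  `1`-separated family of spread `≤ T` (transported from the tree's
  `GuthMaynardReduction.card_le_of_subdivision` on `Finset ℝ` via `s ↦ Im s − min Im`).
* `Jutila1977.sq_le_jutilaG_mul` — the side conditions `a ≥ 1`, `c^k ≤ b` come from `V² ≤ GN`,
  i.e. `|f(s)| ≤ ∑ |a_n| n^{−σ} ≤ (N G)^{1/2}` for `σ ≥ 0` (Cauchy–Schwarz), whenever there is a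
  point at all.

No new definitions, no named facts (net debt 0); (1.2) itself (the Halász–Montgomery argument of
§§2–3) is the business of the sibling F3 files and enters here only as the hypothesis `h`.

## References
* [Jutila1977] M. Jutila, Zero-density estimates for L-functions, Acta Arith. 32 (1977) 55–62 —
  Theorem (1.2)/(1.4) p. 56, the subdivision step p. 60 (page images `gm/lit-jutila1977/page02.png`,
  `page04.png`, read 2026-08-26).
* M. N. Huxley, On the difference between consecutive primes, Invent. Math. 15 (1972) 164–170 —
  Jutila's reference [5], the origin of the subdivision device (context only: no declaration of
  this file cites it; NB the tree's bib key `Huxley1972` is Huxley's Oxford monograph, a different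
  work).
-/

noncomputable section

open Complex

namespace Literature.NumberTheory.LFunctions

namespace Jutila1977

/-! ## 1. The optimisation in `T₀` -/

/-- **The Huxley-subdivision step of Jutila's proof of (1.4)** (p. 60: "we apply (1.2) with
`q = 1`, `T = T₀` and multiply the resulting estimate by `1 + T₀⁻¹T` … an optimal choice of `T₀`
completes the proof"), as a real-variable optimisation: if for every `T₀ ∈ [2, T]`
`R ≤ C (1 + T/T₀)(a + T₀ b + (T₀ c)^k)` with `a ≥ 1`, `b ≥ c^k ≥ 0`, `c > 0` (in Jutila's notation
`a = GNV⁻²`, `b = (G⁴N²V⁻⁸)^k`, `c = G²V⁻⁴`; `a ≥ 1` and `b = c^k a^{2k} ≥ c^k` because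
`V² ≤ GN`), then `R ≤ 2^{k+3} C (a + T a^{1−1/k} c + T b)` — the three terms of (1.4), the middle one being
`T G^{3−1/k} N^{1−1/k} V^{−6+2/k}`. The choice is `T₀ = a^{1/k}/c` (clamped to `[2, T]`).
[cite: Jutila1977, §3, proof of (1.4), p. 60] -/
theorem subdivision_optimisation {R a b c T C : ℝ} {k : ℕ} (hk : 1 ≤ k) (ha : 1 ≤ a)
    (hc : 0 < c) (hcb : c ^ k ≤ b) (hT : 2 ≤ T) (hC : 0 ≤ C)
    (h : ∀ T₀ : ℝ, 2 ≤ T₀ → T₀ ≤ T → R ≤ C * (1 + T / T₀) * (a + T₀ * b + (T₀ * c) ^ k)) :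
    R ≤ 2 ^ (k + 3) * C * (a + T * a ^ (1 - 1 / k : ℝ) * c + T * b) := by
  have hk0 : (0 : ℝ) < k := by exact_mod_cast (by omega : 0 < k)
  have ha0 : 0 < a := by linarith
  have hb : 0 ≤ b := le_trans (pow_nonneg hc.le k) hcb
  have hT0 : 0 < T := by linarith
  -- `a = a^{1/k}^k`, `a^{1-1/k} * a^{1/k} = a`
  set α : ℝ := a ^ (1 / k : ℝ) with hα
  have hα0 : 0 < α := Real.rpow_pos_of_pos ha0 _
  have hα1 : 1 ≤ α := Real.one_le_rpow ha (by positivity)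
  have hαk : α ^ k = a := by
    rw [hα, ← Real.rpow_natCast, ← Real.rpow_mul ha0.le]
    field_simp; exact Real.rpow_one a
  have hsplit : a ^ (1 - 1 / k : ℝ) * α = a := by
    rw [hα, ← Real.rpow_add ha0]; norm_num
  have ha1k : 0 < a ^ (1 - 1 / k : ℝ) := Real.rpow_pos_of_pos ha0 _
  -- the optimal window length
  set T₁ : ℝ := α / c with hT₁
  have hT₁0 : 0 < T₁ := div_pos hα0 hc
  have hT₁c : (T₁ * c) ^ k = a := by
    rw [hT₁, div_mul_cancel₀ _ hc.ne', hαk]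
  -- key: `T/T₁ * a = T a^{1-1/k} c`
  have hmid : T / T₁ * a = T * a ^ (1 - 1 / k : ℝ) * c := by
    rw [hT₁, div_div_eq_mul_div, div_mul_eq_mul_div, div_eq_iff hα0.ne']
    rw [show T * a ^ (1 - 1 / (k : ℝ)) * c * α = T * c * (a ^ (1 - 1 / (k : ℝ)) * α) by ring,
      hsplit]
  have hmid0 : 0 ≤ T * a ^ (1 - 1 / k : ℝ) * c := by positivity
  have hgoal0 : 0 ≤ a + T * a ^ (1 - 1 / k : ℝ) * c + T * b := by positivity
  have h8 : 8 * C * (a + T * a ^ (1 - 1 / k : ℝ) * c + T * b) ≤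
      2 ^ (k + 3) * C * (a + T * a ^ (1 - 1 / k : ℝ) * c + T * b) := by
    have : (8 : ℝ) ≤ 2 ^ (k + 3) := by
      calc (8 : ℝ) = 2 ^ (0 + 3) := by norm_num
        _ ≤ 2 ^ (k + 3) := pow_le_pow_right₀ (by norm_num) (by omega)
    exact mul_le_mul_of_nonneg_right (mul_le_mul_of_nonneg_right this hC) hgoal0
  have h2k1 : (1 : ℝ) ≤ 2 ^ k := one_le_pow₀ (by norm_num)
  have hCa : 0 ≤ C * a := mul_nonneg hC ha0.le
  have hCTb : 0 ≤ C * (T * b) := mul_nonneg hC (by positivity)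
  have hCmid : 0 ≤ C * (T * a ^ (1 - 1 / k : ℝ) * c) := mul_nonneg hC hmid0
  -- three cases for the clamp
  rcases le_or_gt 2 T₁ with h2 | h2
  · rcases le_or_gt T₁ T with hT₁T | hT₁T
    · -- interior: T₀ = T₁
      have hR := h T₁ h2 hT₁T
      have hTT₁ : 1 ≤ T / T₁ := by rw [le_div_iff₀ hT₁0]; linarith
      calc R ≤ C * (1 + T / T₁) * (a + T₁ * b + (T₁ * c) ^ k) := hR
        _ = C * (1 + T / T₁) * (2 * a + T₁ * b) := by rw [hT₁c]; ring
        _ = C * (2 * a + T₁ * b + 2 * (T / T₁ * a) + T * b) := by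
            field_simp
            ring
        _ = C * (2 * a + T₁ * b + 2 * (T * a ^ (1 - 1 / k : ℝ) * c) + T * b) := by rw [hmid]
        _ ≤ C * (2 * a + T * b + 2 * (T * a ^ (1 - 1 / k : ℝ) * c) + T * b) := by
            gcongr
        _ ≤ 8 * C * (a + T * a ^ (1 - 1 / k : ℝ) * c + T * b) := by
            nlinarith [hCa, hCTb, hCmid]
        _ ≤ _ := h8
    · -- `T₁ > T`: take `T₀ = T`; then `(Tc)^k ≤ (T₁ c)^k = a`
      have hR := h T hT le_rfl
      have hTc : (T * c) ^ k ≤ a := by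
        rw [← hT₁c]
        exact pow_le_pow_left₀ (by positivity) (by nlinarith) k
      have hdiv : T / T = 1 := div_self hT0.ne'
      rw [hdiv] at hR
      calc R ≤ C * (1 + 1) * (a + T * b + (T * c) ^ k) := hR
        _ ≤ C * (1 + 1) * (a + T * b + a) := by gcongr
        _ ≤ 8 * C * (a + T * a ^ (1 - 1 / k : ℝ) * c + T * b) := by
            nlinarith [hCa, hCTb, hCmid]
        _ ≤ _ := h8
  · -- `T₁ < 2`: take `T₀ = 2`; then `a = (T₁ c)^k < (2c)^k ≤ 2^k c^k ≤ 2^k b`… but we only need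
    -- `a ≤ 2 a^{1-1/k} c` (from `α < 2c`) and `c^k ≤ b`.
    have hR := h 2 le_rfl hT
    have hα2c : α < 2 * c := by
      rw [hT₁, div_lt_iff₀ hc] at h2; linarith
    have ha_le : a ≤ 2 * (a ^ (1 - 1 / k : ℝ) * c) := by
      calc a = a ^ (1 - 1 / k : ℝ) * α := hsplit.symm
        _ ≤ a ^ (1 - 1 / k : ℝ) * (2 * c) := mul_le_mul_of_nonneg_left hα2c.le ha1k.le
        _ = 2 * (a ^ (1 - 1 / k : ℝ) * c) := by ring
    have h2c : (2 * c) ^ k ≤ 2 ^ k * b := by rw [mul_pow]; gcongr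
    have hT2 : 1 + T / 2 ≤ T := by linarith
    have hbr0 : 0 ≤ a + 2 * b + (2 * c) ^ k := by positivity
    calc R ≤ C * (1 + T / 2) * (a + 2 * b + (2 * c) ^ k) := hR
      _ ≤ C * T * (a + 2 * b + (2 * c) ^ k) := by
          rw [mul_assoc, mul_assoc]
          exact mul_le_mul_of_nonneg_left (mul_le_mul_of_nonneg_right hT2 hbr0) hC
      _ ≤ C * T * (2 * (a ^ (1 - 1 / k : ℝ) * c) + 2 * b + 2 ^ k * b) := by gcongr
      _ = C * (2 * (T * a ^ (1 - 1 / k : ℝ) * c) + (2 + 2 ^ k) * (T * b)) := by ring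
      _ ≤ C * (2 ^ (k + 3) * (T * a ^ (1 - 1 / k : ℝ) * c) + 2 ^ (k + 3) * (T * b)) := by
          have hTb : 0 ≤ T * b := by positivity
          have e1 : (2 : ℝ) ≤ 2 ^ (k + 3) := by
            calc (2 : ℝ) = 2 ^ 1 := by norm_num
              _ ≤ 2 ^ (k + 3) := pow_le_pow_right₀ (by norm_num) (by omega)
          have e2 : (2 : ℝ) + 2 ^ k ≤ 2 ^ (k + 3) := by
            rw [pow_add]; nlinarith
          exact mul_le_mul_of_nonneg_left
            (add_le_add (mul_le_mul_of_nonneg_right e1 hmid0) (mul_le_mul_of_nonneg_right e2 hTb))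
            hC
      _ = 2 ^ (k + 3) * C * (T * a ^ (1 - 1 / k : ℝ) * c + T * b) := by ring
      _ ≤ 2 ^ (k + 3) * C * (a + T * a ^ (1 - 1 / k : ℝ) * c + T * b) :=
          mul_le_mul_of_nonneg_left (by linarith) (mul_nonneg (by positivity) hC)

/-! ## 2. The size of a large value: `V² ≤ G·N` -/

/-- **A large value is at most `(GN)^{1/2}`**: if `σ = Re s ≥ 0` and
`V ≤ |∑_{N<n≤2N} a_n n^{−s}|`, then `V² ≤ G·N` (`|n^{−s}| = n^{−σ} ≤ 1` and Cauchy–Schwarz over the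
`N` terms). In Jutila's proof this is the standing size information `V ≤ G^{1/2}N^{1/2}` that makes
`GNV⁻² ≥ 1` and `(G⁴N²V⁻⁸)^k ≥ (G²V⁻⁴)^k`. [cite: Jutila1977, §1, p. 55 (set-up (1.1), `G`)] -/
theorem sq_le_jutilaG_mul (N : ℕ) (a : ℕ → ℂ) {s : ℂ} (hs : 0 ≤ s.re) {V : ℝ} (hV : 0 ≤ V)
    (h : V ≤ ‖∑ n ∈ Finset.Ioc N (2 * N), a n * (n : ℂ) ^ (-s)‖) :
    V ^ 2 ≤ jutilaG a N * N := by
  have h1 : ‖∑ n ∈ Finset.Ioc N (2 * N), a n * (n : ℂ) ^ (-s)‖ ≤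
      ∑ n ∈ Finset.Ioc N (2 * N), ‖a n‖ * 1 := by
    refine (norm_sum_le _ _).trans (Finset.sum_le_sum fun n hn ↦ ?_)
    have hn : 0 < n := by rw [Finset.mem_Ioc] at hn; omega
    rw [norm_mul, Complex.norm_natCast_cpow_of_pos hn]
    have : (n : ℝ) ^ (-s).re ≤ 1 :=
      Real.rpow_le_one_of_one_le_of_nonpos (by exact_mod_cast hn) (by rw [Complex.neg_re]; linarith)
    exact mul_le_mul_of_nonneg_left this (norm_nonneg _)
  have h2 := Finset.sum_mul_sq_le_sq_mul_sq (Finset.Ioc N (2 * N)) (fun n ↦ ‖a n‖) (fun _ ↦ (1 : ℝ))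
  have hcard : ((Finset.Ioc N (2 * N)).card : ℝ) = N := by
    rw [Nat.card_Ioc, show 2 * N - N = N by omega]
  have hsum1 : ∑ _n ∈ Finset.Ioc N (2 * N), (1 : ℝ) ^ 2 = N := by
    rw [Finset.sum_const, hcard.symm]; simp
  calc V ^ 2 ≤ ‖∑ n ∈ Finset.Ioc N (2 * N), a n * (n : ℂ) ^ (-s)‖ ^ 2 := pow_le_pow_left₀ hV h 2
    _ ≤ (∑ n ∈ Finset.Ioc N (2 * N), ‖a n‖ * 1) ^ 2 := pow_le_pow_left₀ (norm_nonneg _) h1 2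
    _ ≤ (∑ n ∈ Finset.Ioc N (2 * N), ‖a n‖ ^ 2) * ∑ _n ∈ Finset.Ioc N (2 * N), (1 : ℝ) ^ 2 := h2
    _ = jutilaG a N * N := by rw [hsum1, jutilaG]

/-! ## 3. Huxley's subdivision of the points -/

/-- **Huxley's subdivision of the points `s_r`** (Jutila p. 60, citing Huxley [5]): let `S ⊂ ℂ` be a
finite family with `|Im s − Im s'| ≤ T` for all pairs and `|Im s − Im s'| ≥ 1` for distinct points.
If every sub-family lying in a window of length `T₀ > 0` (all pairwise differences of imaginary
parts `≤ T₀`) has at most `B ≥ 0` members, then `#S ≤ (T/T₀ + 1)·B` — "multiply the resulting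
estimate by `1 + T₀⁻¹T`". Transported from `GuthMaynardReduction.card_le_of_subdivision` (windows
of `[0, T] ⊂ ℝ`) along `s ↦ Im s − min Im`, which is injective on `S` by the separation.
[cite: Jutila1977, §3, p. 60 (proof of (1.4))] -/
theorem card_le_of_window_bound {S : Finset ℂ} {T T₀ B : ℝ} (hT : 0 ≤ T) (hT₀ : 0 < T₀)
    (hB : 0 ≤ B) (hspread : ∀ s ∈ S, ∀ s' ∈ S, |s.im - s'.im| ≤ T)
    (hsep : ∀ s ∈ S, ∀ s' ∈ S, s ≠ s' → 1 ≤ |s.im - s'.im|)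
    (hwin : ∀ S' ⊆ S, (∀ s ∈ S', ∀ s' ∈ S', |s.im - s'.im| ≤ T₀) → (S'.card : ℝ) ≤ B) :
    (S.card : ℝ) ≤ (T / T₀ + 1) * B := by
  classical
  rcases S.eq_empty_or_nonempty with hS | hne
  · rw [hS, Finset.card_empty, Nat.cast_zero]; positivity
  obtain ⟨s₀, hs₀, hmin⟩ := S.exists_min_image (fun s ↦ s.im) hne
  set f : ℂ → ℝ := fun s ↦ s.im - s₀.im with hf
  have hinj : Set.InjOn f S := by
    intro s hs s' hs' hss'
    by_contra hne'
    have h1 := hsep s hs s' hs' hne'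
    have h0 : s.im - s'.im = 0 := by simp only [hf] at hss'; linarith
    rw [h0, abs_zero] at h1
    linarith
  set W : Finset ℝ := S.image f with hW
  have hWcard : (W.card : ℝ) = S.card := by rw [Finset.card_image_of_injOn hinj]
  have hWT : ∀ t ∈ W, 0 ≤ t ∧ t ≤ T := by
    intro t ht
    obtain ⟨s, hs, rfl⟩ := Finset.mem_image.mp ht
    refine ⟨by simp only [hf]; linarith [hmin s hs], ?_⟩
    simp only [hf]
    exact (le_abs_self _).trans (hspread s hs s₀ hs₀)
  have hBW : ∀ (t₀ : ℝ), ∀ W' ⊆ W, (∀ t ∈ W', t₀ ≤ t ∧ t ≤ t₀ + T₀) → (W'.card : ℝ) ≤ B := by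
    intro t₀ W' hW'W hW'win
    set S' : Finset ℂ := S.filter (fun s ↦ f s ∈ W') with hS'
    have hS'S : S' ⊆ S := Finset.filter_subset _ _
    have hsub : W' ⊆ S'.image f := by
      intro t ht
      obtain ⟨s, hs, rfl⟩ := Finset.mem_image.mp (hW'W ht)
      exact Finset.mem_image.mpr ⟨s, Finset.mem_filter.mpr ⟨hs, ht⟩, rfl⟩
    have h1 : W'.card ≤ S'.card := (Finset.card_le_card hsub).trans Finset.card_image_le
    have h2 : (S'.card : ℝ) ≤ B := by
      refine hwin S' hS'S fun s hs s' hs' ↦ ?_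
      have hs1 := hW'win _ (Finset.mem_filter.mp hs).2
      have hs2 := hW'win _ (Finset.mem_filter.mp hs').2
      simp only [hf] at hs1 hs2
      rw [abs_le]
      constructor <;> linarith [hs1.1, hs1.2, hs2.1, hs2.2]
    exact le_trans (by exact_mod_cast h1) h2
  have hmain := GuthMaynardReduction.card_le_of_subdivision hT hT₀ hB W hWT hBW
  rwa [hWcard] at hmain

/-! ## 4. (1.4) from (1.2) at `q = 1` -/

/-- **Jutila 1977, Theorem: (1.4) follows from (1.2) with `q = 1`** — the last paragraph of §3
(p. 60): «Finally, for the proof of (1.4), we use (1.2) and the Huxley [5] subdivision of the points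
`s_r`. It means we apply (1.2) with `q = 1`, `T = T₀` and multiply the resulting estimate by
`1 + T₀⁻¹T` to get an estimate for `R`; an optimal choice of `T₀` completes the proof.»
The hypothesis `h` is (1.2), «`R₁ ≪_{ε,k} (GNV⁻² + qT(G⁴N²V⁻⁸)^k + (qTG²V⁻⁴)^k)(qT)^ε`», AT `q = 1`
(all characters `χ₀ mod 1`, i.e. plain Dirichlet polynomials — then `R₁ = R₃`), typed in exactly
the binders of `Jutila1977_theorem_1_4`; the conclusion is `Jutila1977_theorem_1_4` with the constant
`2^{k+3}·max(C, 0)`. Proof as printed: for `T₀ ∈ [2, T]` every sub-family in a window of length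
`T₀` obeys (1.2) with `T = T₀` (and `T₀^ε ≤ T^ε`), Huxley's subdivision (`card_le_of_window_bound`)
multiplies by `1 + T/T₀`, and `subdivision_optimisation` chooses `T₀`; the side conditions
`GNV⁻² ≥ 1`, `(G²V⁻⁴)^k ≤ (G⁴N²V⁻⁸)^k` hold because `V² ≤ GN` (`sq_le_jutilaG_mul`) as soon as
there is a point (for no points the bound is trivial).
[cite: Jutila1977, Theorem, (1.2) and (1.4), p. 56; proof of (1.4), §3, p. 60] -/
theorem theorem_1_4_of_theorem_1_2
    (h : ∀ k : ℕ, 1 ≤ k → ∀ ε : ℝ, 0 < ε → ∃ C : ℝ,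
      ∀ (N : ℕ) (T V : ℝ) (a : ℕ → ℂ) (S : Finset ℂ),
      1 ≤ N → 2 ≤ T → 0 < V →
      (∀ s ∈ S, 0 ≤ s.re) → (∀ s ∈ S, ∀ s' ∈ S, |s.im - s'.im| ≤ T) →
      (∀ s ∈ S, ∀ s' ∈ S, s ≠ s' → 1 ≤ |s.im - s'.im|) →
      (∀ s ∈ S, V ≤ ‖∑ n ∈ Finset.Ioc N (2 * N), a n * (n : ℂ) ^ (-s)‖) →
      (S.card : ℝ) ≤ C * (jutilaG a N * N * V ^ (-2 : ℝ) +
        T * (jutilaG a N ^ 4 * (N : ℝ) ^ 2 * V ^ (-8 : ℝ)) ^ k +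
        (T * jutilaG a N ^ 2 * V ^ (-4 : ℝ)) ^ k) * T ^ ε) :
    Jutila1977_theorem_1_4 := by
  intro k hk ε hε
  obtain ⟨C, hC⟩ := h k hk ε hε
  refine ⟨2 ^ (k + 3) * max C 0, fun N T V a S hN hT hV hre hspread hsep hlarge ↦ ?_⟩
  have hk0 : (0 : ℝ) < k := by exact_mod_cast (by omega : 0 < k)
  have hN0 : (0 : ℝ) < N := by exact_mod_cast (by omega : 0 < N)
  have hT0 : 0 < T := by linarith
  have hC0 : 0 ≤ max C 0 := le_max_right _ _
  set G : ℝ := jutilaG a N with hG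
  have hG0 : 0 ≤ G := jutilaG_nonneg a N
  have hTε : 0 < T ^ ε := Real.rpow_pos_of_pos hT0 ε
  -- no points: the bound is trivially true
  rcases S.eq_empty_or_nonempty with hS | hne
  · rw [hS, Finset.card_empty, Nat.cast_zero]
    have h1 : 0 ≤ G ^ (3 - 1 / k : ℝ) := Real.rpow_nonneg hG0 _
    have h2 : 0 ≤ (N : ℝ) ^ (1 - 1 / k : ℝ) := Real.rpow_nonneg hN0.le _
    have h3 : 0 < V ^ (-6 + 2 / k : ℝ) := Real.rpow_pos_of_pos hV _
    have h4 : 0 < V ^ (-2 : ℝ) := Real.rpow_pos_of_pos hV _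
    have h5 : 0 < V ^ (-8 : ℝ) := Real.rpow_pos_of_pos hV _
    positivity
  -- there is a point: `V² ≤ GN`, hence `G > 0`
  obtain ⟨s₀, hs₀⟩ := hne
  have hVGN : V ^ 2 ≤ G * N := sq_le_jutilaG_mul N a (hre s₀ hs₀) hV.le (hlarge s₀ hs₀)
  have hGpos : 0 < G := by
    rcases hG0.lt_or_eq with hlt | heq
    · exact hlt
    · exfalso; rw [← heq, zero_mul] at hVGN; nlinarith
  -- the three quantities `a = GNV⁻²`, `b = (G⁴N²V⁻⁸)^k`, `c = G²V⁻⁴` of the optimisation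
  set u : ℝ := V ^ (-2 : ℝ) with hu
  have hu0 : 0 < u := Real.rpow_pos_of_pos hV _
  have huV : u * V ^ 2 = 1 := by
    rw [hu, Real.rpow_neg hV.le, Real.rpow_two, inv_mul_cancel₀ (pow_pos hV 2).ne']
  have hV4 : V ^ (-4 : ℝ) = u * u := by
    rw [hu, ← Real.rpow_add hV]; norm_num
  have hV8 : V ^ (-8 : ℝ) = (u * u) * (u * u) := by
    rw [hu, ← Real.rpow_add hV, ← Real.rpow_add hV]; norm_num
  set A : ℝ := G * N * u with hA
  have hA1 : 1 ≤ A := by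
    -- `A = GN/V²` and `V² ≤ GN`
    have : A * V ^ 2 = G * N := by rw [hA, mul_assoc, huV, mul_one]
    nlinarith [pow_pos hV 2]
  have hA0 : 0 < A := by linarith
  set c : ℝ := G ^ 2 * V ^ (-4 : ℝ) with hc
  have hc0 : 0 < c := by positivity
  have hcA : c * (N : ℝ) ^ 2 = A ^ 2 := by rw [hc, hA, hV4]; ring
  set b : ℝ := (G ^ 4 * (N : ℝ) ^ 2 * V ^ (-8 : ℝ)) ^ k with hb
  have hcb : c ^ k ≤ b := by
    rw [hb]
    apply pow_le_pow_left₀ hc0.le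
    -- `c ≤ c · (c N²) = c A²` since `A ≥ 1`
    have hbase : G ^ 4 * (N : ℝ) ^ 2 * V ^ (-8 : ℝ) = c * (c * (N : ℝ) ^ 2) := by
      rw [hc, hV8, hV4]; ring
    rw [hbase, hcA]
    have : 1 ≤ A ^ 2 := by nlinarith
    nlinarith
  -- for every admissible window length `T₀`, (1.2) on each window and Huxley's subdivision
  have hwindows : ∀ T₀ : ℝ, 2 ≤ T₀ → T₀ ≤ T →
      (S.card : ℝ) ≤ max C 0 * T ^ ε * (1 + T / T₀) * (A + T₀ * b + (T₀ * c) ^ k) := by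
    intro T₀ h2 hT₀T
    have hT₀0 : 0 < T₀ := by linarith
    have hin0 : 0 ≤ A + T₀ * b + (T₀ * c) ^ k := by positivity
    have hB0 : 0 ≤ max C 0 * (A + T₀ * b + (T₀ * c) ^ k) * T ^ ε := by positivity
    have hstep := card_le_of_window_bound (S := S) (T := T) (T₀ := T₀)
      (B := max C 0 * (A + T₀ * b + (T₀ * c) ^ k) * T ^ ε) hT0.le hT₀0 hB0 hspread hsep ?_
    · calc (S.card : ℝ) ≤ (T / T₀ + 1) * (max C 0 * (A + T₀ * b + (T₀ * c) ^ k) * T ^ ε) := hstep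
        _ = max C 0 * T ^ ε * (1 + T / T₀) * (A + T₀ * b + (T₀ * c) ^ k) := by ring
    · intro S' hS'S hS'spread
      have h12 := hC N T₀ V a S' hN h2 hV (fun s hs ↦ hre s (hS'S hs)) hS'spread
        (fun s hs s' hs' ↦ hsep s (hS'S hs) s' (hS'S hs')) (fun s hs ↦ hlarge s (hS'S hs))
      have hshape : jutilaG a N * N * V ^ (-2 : ℝ) +
          T₀ * (jutilaG a N ^ 4 * (N : ℝ) ^ 2 * V ^ (-8 : ℝ)) ^ k +
          (T₀ * jutilaG a N ^ 2 * V ^ (-4 : ℝ)) ^ k = A + T₀ * b + (T₀ * c) ^ k := by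
        rw [hA, hb, hc, hu, ← hG]; ring
      rw [hshape] at h12
      have hTε' : T₀ ^ ε ≤ T ^ ε := Real.rpow_le_rpow hT₀0.le hT₀T hε.le
      calc (S'.card : ℝ) ≤ C * (A + T₀ * b + (T₀ * c) ^ k) * T₀ ^ ε := h12
        _ ≤ max C 0 * (A + T₀ * b + (T₀ * c) ^ k) * T₀ ^ ε := by
            gcongr; exact le_max_left _ _
        _ ≤ max C 0 * (A + T₀ * b + (T₀ * c) ^ k) * T ^ ε := by gcongr
  -- the optimal choice of `T₀`
  have hopt := subdivision_optimisation (R := (S.card : ℝ)) hk hA1 hc0 hcb hT (by positivity)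
    hwindows
  -- `A^{1−1/k}·c = G^{3−1/k} N^{1−1/k} V^{−6+2/k}`
  have e1 : G ^ (3 - 1 / k : ℝ) = G ^ (1 - 1 / k : ℝ) * G ^ 2 := by
    rw [show (3 - 1 / k : ℝ) = (1 - 1 / k) + 2 by ring, Real.rpow_add hGpos, Real.rpow_two]
  have e2 : V ^ (-6 + 2 / k : ℝ) = u ^ (1 - 1 / k : ℝ) * V ^ (-4 : ℝ) := by
    rw [hu, ← Real.rpow_mul hV.le, ← Real.rpow_add hV]
    congr 1; ring
  have e3 : A ^ (1 - 1 / k : ℝ) = G ^ (1 - 1 / k : ℝ) * (N : ℝ) ^ (1 - 1 / k : ℝ) * u ^ (1 - 1 / k : ℝ) := by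
    rw [hA, Real.mul_rpow (by positivity) hu0.le, Real.mul_rpow hG0 hN0.le]
  have hconv : A ^ (1 - 1 / k : ℝ) * c =
      G ^ (3 - 1 / k : ℝ) * (N : ℝ) ^ (1 - 1 / k : ℝ) * V ^ (-6 + 2 / k : ℝ) := by
    rw [e3, e1, e2, hc]; ring
  calc (S.card : ℝ) ≤ 2 ^ (k + 3) * (max C 0 * T ^ ε) * (A + T * A ^ (1 - 1 / k : ℝ) * c + T * b) :=
        hopt
    _ = 2 ^ (k + 3) * max C 0 * (A + T * (A ^ (1 - 1 / k : ℝ) * c) + T * b) * T ^ ε := by ring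
    _ = 2 ^ (k + 3) * max C 0 * (G * N * V ^ (-2 : ℝ) +
          T * G ^ (3 - 1 / k : ℝ) * (N : ℝ) ^ (1 - 1 / k : ℝ) * V ^ (-6 + 2 / k : ℝ) +
          T * (G ^ 4 * (N : ℝ) ^ 2 * V ^ (-8 : ℝ)) ^ k) * T ^ ε := by
        rw [hconv, hA, hb, hu]; ring

end Jutila1977

end Literature.NumberTheory.LFunctions

end
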